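import Mathlib.MeasureTheory.Measure.Lebesgue.EqHaar
import Mathlib.Analysis.Calculus.BumpFunction.FiniteDimension
import Mathlib.Analysis.Calculus.BumpFunction.Normed
import Mathlib.Analysis.Normed.Ring.Units
import Literature.NumberTheory.Automorphic.TestFunctionLieDeriv
import Literature.NumberTheory.Automorphic.ArchFlowParametricIntegral
import HarnessLib

/-!
# Linear coordinates on `GL_n(K_∞)`: pull-backs of functions, right-translation flows, Lebesgue
# measure and a cut-off at the identity

Topic `NumberTheory/Automorphic`. Infrastructure for the local `L²` analysis of automorphic forms
in the archimedean variable (the a-priori form of Nelson's estimate and the Sobolev box lemma on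
`GL_n(K_∞)`, by which `K_∞`-finite `Z(𝔤)`-finite elements of stable spaces have uniformly moderate
growth). Everything is elementary:

* `glCoord n K : M_n(K_∞) ≃L[ℝ] (GlIdx n K → ℝ)` — the coordinates in the real basis `glInfBasis`
  (`GlIdx n K = Fin (dim_ℝ M_n(K_∞))`), `matOf` its inverse; `glUnitSet n K` — the (open) set of
  coordinates of invertible matrices; `glUnitChart n K` — `val : GL_n(K_∞) → M_n(K_∞)` as an
  open partial homeomorphism (Mathlib's `Units.isOpenEmbedding_val`);
* `unitPull G : (GlIdx n K → ℝ) → ℂ` — a function `G` on `GL_n(K_∞)` read in coordinates and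
  extended by `0` off `glUnitSet` (an indicator); `unitPull_glCoord` (`unitPull G (coords of g)
  = G g`), `continuousOn_unitPull`;
* `rFlow h` — right multiplication by a matrix `h` in coordinates, a real *linear* map of
  `GlIdx n K → ℝ`; `matOf_rFlow`, `rFlow_mul`, `unitPull_rFlow` (`unitPull G ∘ rFlow h` is the
  pull-back of `g ↦ G (g h)`), `det_rFlow_ne_zero`, and `integral_comp_rFlow`: Lebesgue measure
  is only rescaled by right translations, `∫ Ψ (rFlow h s) ds = |det (rFlow h)|⁻¹ ∫ Ψ`
  (`map_linearMap_addHaar_eq_smul_addHaar`);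
* `orbitPull hcpt y F = unitPull (g ↦ F (y · ι(g)))` for `F` on `GL_n(𝔸_K)` and `y ∈ GL_n(𝔸_K)`;
  `hasDerivAt_orbitPull_rFlow`: along `t ↦ rFlow (exp tX)` its derivative at `t = 0` is
  `orbitPull hcpt y (X F)` (the Lie derivative, through `IsArchSmooth.hasDerivAt_flow_zero`),
  at every point (both sides vanish off the units);
* `glCutoff n K` — a smooth bump `χ` on `GlIdx n K → ℝ`, `0 ≤ χ ≤ 1`, equal to `1` near the
  coordinates of `1` and supported inside `glUnitSet n K`; `continuous_mul_unitPull_of_tsupport_subset`.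

No named facts; definitions with their API.

## References

* E. Nelson, *Analytic vectors*, Ann. of Math. 70 (1959), §6 [Nelson1959] (not held) — the
  application.
* A. Borel, H. Jacquet, *Automorphic forms and automorphic representations*, Proc. Sympos. Pure
  Math. 33 (1979), Part 1, §1.1–1.5 [BorelJacquetCorvallis1979].
-/

noncomputable section

open scoped MatrixGroups Matrix ContDiff Topology Classical
open Filter MeasureTheory NumberField NumberField.mixedEmbedding IsDedekindDomain Set

namespace Literature.NumberTheory.Automorphic

-- `M_n(K_∞)` is finite-dimensional over `ℝ` (a theorem used as a local instance, as in
-- `TestFunctionLieDeriv`)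
attribute [local instance] finiteDimensional_matrix_mixedSpace

-- the scoped operator norm on `𝔤𝔩_n(K_∞)`, as in `ArchimedeanCalculus`
open scoped Matrix.Norms.Operator

variable (n : ℕ) (K : Type) [Field K] [NumberField K]

/-! ### 1. Coordinates, units, pull-backs -/

/-- The index type of the real basis `glInfBasis` of `M_n(K_∞)` (so that `GlIdx n K → ℝ` is the
coordinate space). [folklore] -/
abbrev GlIdx : Type := Fin (Module.finrank ℝ (Matrix (Fin n) (Fin n) (mixedSpace K)))

/-- **Linear coordinates on `M_n(K_∞)`**: the coordinate map of the real basis `glInfBasis`, as a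
continuous linear equivalence `M_n(K_∞) ≃L[ℝ] (GlIdx n K → ℝ)`. [folklore] -/
def glCoord : Matrix (Fin n) (Fin n) (mixedSpace K) ≃L[ℝ] (GlIdx n K → ℝ) :=
  (glInfBasis n K).equivFun.toContinuousLinearEquiv

/-- `val : GL_n(K_∞) → M_n(K_∞)` as an open partial homeomorphism onto the invertible matrices
(Mathlib's `Units.isOpenEmbedding_val` for the complete normed ring `M_n(K_∞)`). [folklore] -/
def glUnitChart : OpenPartialHomeomorph (GL (Fin n) (mixedSpace K)) (Matrix (Fin n) (Fin n) (mixedSpace K)) :=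
  (Units.isOpenEmbedding_val (R := Matrix (Fin n) (Fin n) (mixedSpace K))).toOpenPartialHomeomorph Units.val

variable {n K}

/-- The matrix with coordinates `s`. [folklore] -/
abbrev matOf (s : GlIdx n K → ℝ) : Matrix (Fin n) (Fin n) (mixedSpace K) := (glCoord n K).symm s

/-- `matOf` inverts `glCoord`. [folklore] -/
@[simp] theorem matOf_glCoord (M : Matrix (Fin n) (Fin n) (mixedSpace K)) : matOf (glCoord n K M) = M :=
  (glCoord n K).symm_apply_apply M

/-- `glCoord` inverts `matOf`. [folklore] -/
@[simp] theorem glCoord_matOf (s : GlIdx n K → ℝ) : glCoord n K (matOf s) = s :=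
  (glCoord n K).apply_symm_apply s

/-- The chart inverts `val` on `GL_n(K_∞)`. [folklore] -/
theorem glUnitChart_symm_coe (g : GL (Fin n) (mixedSpace K)) :
    (glUnitChart n K).symm (g : Matrix (Fin n) (Fin n) (mixedSpace K)) = g := by
  rw [glUnitChart]
  exact (Units.isOpenEmbedding_val (R := Matrix (Fin n) (Fin n) (mixedSpace K))).toOpenPartialHomeomorph_left_inv
    Units.val

/-- `val` inverts the chart on invertible matrices. [folklore] -/
theorem coe_glUnitChart_symm {M : Matrix (Fin n) (Fin n) (mixedSpace K)} (hM : IsUnit M) :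
    ((glUnitChart n K).symm M : Matrix (Fin n) (Fin n) (mixedSpace K)) = M := by
  obtain ⟨g, rfl⟩ := hM
  rw [glUnitChart_symm_coe]

variable (n K) in
/-- The (open) set of coordinates of invertible matrices. [folklore] -/
def glUnitSet : Set (GlIdx n K → ℝ) := {s | IsUnit (matOf s)}

/-- Membership in `glUnitSet`. [folklore] -/
theorem mem_glUnitSet_iff (s : GlIdx n K → ℝ) : s ∈ glUnitSet n K ↔ IsUnit (matOf s) := Iff.rfl

/-- The coordinates of an invertible matrix lie in `glUnitSet`. [folklore] -/
theorem glCoord_coe_mem_glUnitSet (g : GL (Fin n) (mixedSpace K)) :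
    glCoord n K (g : Matrix (Fin n) (Fin n) (mixedSpace K)) ∈ glUnitSet n K := by
  rw [mem_glUnitSet_iff, matOf_glCoord]
  exact Units.isUnit g

/-- `glUnitSet` is open (the units of the complete normed ring `M_n(K_∞)` form an open set).
[folklore] -/
theorem isOpen_glUnitSet : IsOpen (glUnitSet n K) :=
  (Units.isOpen (R := Matrix (Fin n) (Fin n) (mixedSpace K))).preimage (glCoord n K).symm.continuous

/-- The unit attached to a point of `glUnitSet`, `s ↦ val⁻¹ (matOf s)`, is continuous on
`glUnitSet` (with values in `GL_n(K_∞)`). [folklore] -/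
theorem continuousOn_glUnitChart_symm_matOf :
    ContinuousOn (fun s : GlIdx n K → ℝ ↦ (glUnitChart n K).symm (matOf s)) (glUnitSet n K) := by
  refine (glUnitChart n K).continuousOn_symm.comp (glCoord n K).symm.continuous.continuousOn
    fun s hs ↦ ?_
  rw [glUnitChart, Topology.IsOpenEmbedding.toOpenPartialHomeomorph_target]
  exact hs

/-- **A function on `GL_n(K_∞)` read in coordinates**, extended by `0` off the invertible matrices
(the indicator of `glUnitSet` times `G ∘ val⁻¹ ∘ matOf`). [folklore] -/
def unitPull (G : GL (Fin n) (mixedSpace K) → ℂ) : (GlIdx n K → ℝ) → ℂ :=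
  (glUnitSet n K).indicator fun s ↦ G ((glUnitChart n K).symm (matOf s))

/-- `unitPull` on the units. [folklore] -/
theorem unitPull_of_mem (G : GL (Fin n) (mixedSpace K) → ℂ) {s : GlIdx n K → ℝ}
    (h : s ∈ glUnitSet n K) : unitPull G s = G ((glUnitChart n K).symm (matOf s)) :=
  indicator_of_mem h _

/-- `unitPull` vanishes off the units. [folklore] -/
theorem unitPull_of_not_mem (G : GL (Fin n) (mixedSpace K) → ℂ) {s : GlIdx n K → ℝ}
    (h : s ∉ glUnitSet n K) : unitPull G s = 0 :=
  indicator_of_notMem h _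

/-- `unitPull G` at the coordinates of `g ∈ GL_n(K_∞)` is `G g`. [folklore] -/
@[simp]
theorem unitPull_glCoord (G : GL (Fin n) (mixedSpace K) → ℂ) (g : GL (Fin n) (mixedSpace K)) :
    unitPull G (glCoord n K (g : Matrix (Fin n) (Fin n) (mixedSpace K))) = G g := by
  rw [unitPull_of_mem G (glCoord_coe_mem_glUnitSet g), matOf_glCoord, glUnitChart_symm_coe]

/-- `unitPull` is additive. [folklore] -/
theorem unitPull_add (G₁ G₂ : GL (Fin n) (mixedSpace K) → ℂ) :
    unitPull (G₁ + G₂) = unitPull G₁ + unitPull G₂ :=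
  indicator_add' _ _ _

/-- `unitPull` is homogeneous. [folklore] -/
theorem unitPull_smul (c : ℂ) (G : GL (Fin n) (mixedSpace K) → ℂ) :
    unitPull (c • G) = c • unitPull G := by
  funext s
  by_cases h : s ∈ glUnitSet n K
  · simp only [Pi.smul_apply, unitPull_of_mem _ h]
  · simp only [Pi.smul_apply, unitPull_of_not_mem _ h, smul_zero]

/-- `unitPull` commutes with pointwise products. [folklore] -/
theorem unitPull_mul (G₁ G₂ : GL (Fin n) (mixedSpace K) → ℂ) :
    unitPull (G₁ * G₂) = unitPull G₁ * unitPull G₂ := by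
  funext s
  by_cases h : s ∈ glUnitSet n K
  · simp only [Pi.mul_apply, unitPull_of_mem _ h]
  · simp only [Pi.mul_apply, unitPull_of_not_mem _ h, mul_zero]

/-- `unitPull` commutes with complex conjugation. [folklore] -/
theorem unitPull_star (G : GL (Fin n) (mixedSpace K) → ℂ) :
    unitPull (star G) = star (unitPull G) := by
  funext s
  by_cases h : s ∈ glUnitSet n K
  · simp only [Pi.star_apply, unitPull_of_mem _ h]
  · simp only [Pi.star_apply, unitPull_of_not_mem _ h, star_zero]

/-- Pointwise bound: `‖unitPull G s‖ ≤ C` if `‖G g‖ ≤ C` for all `g` (and `0 ≤ C`). [folklore] -/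
theorem norm_unitPull_le {G : GL (Fin n) (mixedSpace K) → ℂ} {C : ℝ} (hC : 0 ≤ C)
    (h : ∀ g, ‖G g‖ ≤ C) (s : GlIdx n K → ℝ) : ‖unitPull G s‖ ≤ C := by
  by_cases hs : s ∈ glUnitSet n K
  · rw [unitPull_of_mem G hs]; exact h _
  · rw [unitPull_of_not_mem G hs, norm_zero]; exact hC

/-- `unitPull G` is continuous on `glUnitSet` for continuous `G`. [folklore] -/
theorem continuousOn_unitPull {G : GL (Fin n) (mixedSpace K) → ℂ} (hG : Continuous G) :
    ContinuousOn (unitPull G) (glUnitSet n K) :=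
  (hG.comp_continuousOn continuousOn_glUnitChart_symm_matOf).congr fun _ hs ↦ unitPull_of_mem G hs

/-- The support of `unitPull G` lies in `glUnitSet`. [folklore] -/
theorem support_unitPull_subset (G : GL (Fin n) (mixedSpace K) → ℂ) :
    Function.support (unitPull G) ⊆ glUnitSet n K :=
  support_indicator_subset

/-- **Continuity of cut-off products**: if `χ` is continuous with `tsupport χ ⊆ glUnitSet` and `G`
is continuous, then `s ↦ χ s * unitPull G s` is continuous on all of the coordinate space.
[folklore] -/
theorem continuous_mul_unitPull_of_tsupport_subset {χ : (GlIdx n K → ℝ) → ℂ} (hχ : Continuous χ)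
    (hsupp : tsupport χ ⊆ glUnitSet n K) {G : GL (Fin n) (mixedSpace K) → ℂ} (hG : Continuous G) :
    Continuous fun s ↦ χ s * unitPull G s := by
  refine continuous_iff_continuousAt.2 fun s ↦ ?_
  by_cases hs : s ∈ glUnitSet n K
  · exact (hχ.continuousAt.mul ((continuousOn_unitPull hG).continuousAt
      (isOpen_glUnitSet.mem_nhds hs)))
  · -- off `glUnitSet`, `s ∉ tsupport χ`, so the product vanishes near `s`
    have hs' : s ∉ tsupport χ := fun h ↦ hs (hsupp h)
    have h0 : (fun s ↦ χ s * unitPull G s) =ᶠ[𝓝 s] fun _ ↦ 0 := by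
      have : χ =ᶠ[𝓝 s] 0 := notMem_tsupport_iff_eventuallyEq.1 hs'
      filter_upwards [this] with x hx
      rw [hx, Pi.zero_apply, zero_mul]
    exact (continuousAt_congr h0).2 continuousAt_const

/-- Compact support of cut-off products. [folklore] -/
theorem hasCompactSupport_mul_unitPull {χ : (GlIdx n K → ℝ) → ℂ} (hχ : HasCompactSupport χ)
    (G : GL (Fin n) (mixedSpace K) → ℂ) : HasCompactSupport fun s ↦ χ s * unitPull G s :=
  hχ.mul_right

/-! ### 2. Right translations as linear maps of the coordinate space -/

/-- **Right multiplication by `h ∈ M_n(K_∞)` in coordinates**, a real linear map of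
`GlIdx n K → ℝ`. [folklore] -/
def rFlow (h : Matrix (Fin n) (Fin n) (mixedSpace K)) : (GlIdx n K → ℝ) →ₗ[ℝ] (GlIdx n K → ℝ) :=
  (glCoord n K).toLinearEquiv.toLinearMap ∘ₗ LinearMap.mulRight ℝ h ∘ₗ
    (glCoord n K).symm.toLinearEquiv.toLinearMap

/-- `matOf (rFlow h s) = matOf s * h`. [folklore] -/
@[simp] theorem matOf_rFlow (h : Matrix (Fin n) (Fin n) (mixedSpace K)) (s : GlIdx n K → ℝ) :
    matOf (rFlow h s) = matOf s * h := by
  simp [rFlow, matOf]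

/-- `rFlow h s` in terms of `glCoord`. [folklore] -/
theorem rFlow_apply (h : Matrix (Fin n) (Fin n) (mixedSpace K)) (s : GlIdx n K → ℝ) :
    rFlow h s = glCoord n K (matOf s * h) := by
  simp [rFlow, matOf]

/-- `rFlow 1 = id`. [folklore] -/
@[simp] theorem rFlow_one : rFlow (1 : Matrix (Fin n) (Fin n) (mixedSpace K)) = LinearMap.id :=
  LinearMap.ext fun s ↦ by rw [rFlow_apply, mul_one, LinearMap.id_apply, glCoord_matOf]

/-- `rFlow (h₁ h₂) = rFlow h₂ ∘ rFlow h₁` (a right action). [folklore] -/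
theorem rFlow_mul (h₁ h₂ : Matrix (Fin n) (Fin n) (mixedSpace K)) :
    rFlow (h₁ * h₂) = rFlow h₂ ∘ₗ rFlow h₁ :=
  LinearMap.ext fun s ↦ by rw [LinearMap.comp_apply, rFlow_apply, rFlow_apply, rFlow_apply, matOf_glCoord, mul_assoc]

/-- `rFlow (h₁ h₂) s = rFlow h₂ (rFlow h₁ s)`. [folklore] -/
theorem rFlow_mul_apply (h₁ h₂ : Matrix (Fin n) (Fin n) (mixedSpace K)) (s : GlIdx n K → ℝ) :
    rFlow (h₁ * h₂) s = rFlow h₂ (rFlow h₁ s) := by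
  rw [rFlow_mul]; rfl

/-- `rFlow` is continuous (a linear map of a finite-dimensional space). [folklore] -/
theorem continuous_rFlow (h : Matrix (Fin n) (Fin n) (mixedSpace K)) : Continuous (rFlow h) :=
  LinearMap.continuous_of_finiteDimensional _

/-- `rFlow g` for `g ∈ GL_n(K_∞)` as a linear equivalence (inverse `rFlow g⁻¹`). [folklore] -/
def rFlowEquiv (g : GL (Fin n) (mixedSpace K)) : (GlIdx n K → ℝ) ≃ₗ[ℝ] (GlIdx n K → ℝ) :=
  LinearEquiv.ofLinear (rFlow (g : Matrix (Fin n) (Fin n) (mixedSpace K)))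
    (rFlow ((g⁻¹ : GL (Fin n) (mixedSpace K)) : Matrix (Fin n) (Fin n) (mixedSpace K)))
    (by rw [← rFlow_mul, Units.inv_mul, rFlow_one])
    (by rw [← rFlow_mul, Units.mul_inv, rFlow_one])

/-- `rFlowEquiv g` is `rFlow g` as a linear map. [folklore] -/
@[simp] theorem coe_rFlowEquiv (g : GL (Fin n) (mixedSpace K)) :
    (rFlowEquiv g : (GlIdx n K → ℝ) →ₗ[ℝ] (GlIdx n K → ℝ)) = rFlow (g : Matrix (Fin n) (Fin n) (mixedSpace K)) :=
  rfl

/-- `det (rFlow g) ≠ 0` for `g ∈ GL_n(K_∞)`. [folklore] -/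
theorem det_rFlow_ne_zero (g : GL (Fin n) (mixedSpace K)) :
    LinearMap.det (rFlow (g : Matrix (Fin n) (Fin n) (mixedSpace K))) ≠ 0 := by
  rw [← coe_rFlowEquiv, ← LinearEquiv.coe_det]
  exact Units.ne_zero _

/-- `rFlow g` preserves `glUnitSet` for `g ∈ GL_n(K_∞)`, both ways. [folklore] -/
theorem rFlow_mem_glUnitSet_iff (g : GL (Fin n) (mixedSpace K)) (s : GlIdx n K → ℝ) :
    rFlow (g : Matrix (Fin n) (Fin n) (mixedSpace K)) s ∈ glUnitSet n K ↔ s ∈ glUnitSet n K := by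
  rw [mem_glUnitSet_iff, mem_glUnitSet_iff, matOf_rFlow]
  constructor
  · intro h
    have e : matOf s = matOf s * (g : Matrix (Fin n) (Fin n) (mixedSpace K)) *
        ((g⁻¹ : GL (Fin n) (mixedSpace K)) : Matrix (Fin n) (Fin n) (mixedSpace K)) := by
      rw [mul_assoc, Units.mul_inv, mul_one]
    rw [e]
    exact h.mul (Units.isUnit _)
  · intro h
    exact h.mul (Units.isUnit g)

/-- **Pull-backs under right translation**: `unitPull G (rFlow g s) = unitPull (G (· g)) s` for
`g ∈ GL_n(K_∞)`. [folklore] -/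
theorem unitPull_rFlow (G : GL (Fin n) (mixedSpace K) → ℂ) (g : GL (Fin n) (mixedSpace K))
    (s : GlIdx n K → ℝ) :
    unitPull G (rFlow (g : Matrix (Fin n) (Fin n) (mixedSpace K)) s) = unitPull (fun u ↦ G (u * g)) s := by
  by_cases hs : s ∈ glUnitSet n K
  · have hs' := (rFlow_mem_glUnitSet_iff g s).2 hs
    rw [unitPull_of_mem G hs', unitPull_of_mem _ hs, matOf_rFlow]
    congr 1
    set u := (glUnitChart n K).symm (matOf s) with hu
    have hval : (u : Matrix (Fin n) (Fin n) (mixedSpace K)) = matOf s := coe_glUnitChart_symm hs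
    rw [← hval, ← Units.val_mul, glUnitChart_symm_coe]
  · have hs' : rFlow (g : Matrix (Fin n) (Fin n) (mixedSpace K)) s ∉ glUnitSet n K :=
      fun h ↦ hs ((rFlow_mem_glUnitSet_iff g s).1 h)
    rw [unitPull_of_not_mem G hs', unitPull_of_not_mem _ hs]

/-- `rFlow g` for `g ∈ GL_n(K_∞)` as a measurable equivalence of the coordinate space. [folklore] -/
def rFlowMeasurableEquiv (g : GL (Fin n) (mixedSpace K)) : (GlIdx n K → ℝ) ≃ᵐ (GlIdx n K → ℝ) :=
  (rFlowEquiv g).toContinuousLinearEquiv.toHomeomorph.toMeasurableEquiv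

/-- `rFlowMeasurableEquiv g` is `rFlow g` as a function. [folklore] -/
@[simp] theorem coe_rFlowMeasurableEquiv (g : GL (Fin n) (mixedSpace K)) :
    (rFlowMeasurableEquiv g : (GlIdx n K → ℝ) → (GlIdx n K → ℝ)) = rFlow (g : Matrix (Fin n) (Fin n) (mixedSpace K)) :=
  rfl

/-- **Lebesgue measure is rescaled by right translations**:
`∫ Ψ (rFlow g s) ds = |det (rFlow g)|⁻¹ ∫ Ψ` (`map_linearMap_addHaar_eq_smul_addHaar`; no
measurability needed, `rFlow g` being a measurable equivalence). [folklore] -/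
theorem integral_comp_rFlow (g : GL (Fin n) (mixedSpace K)) (Ψ : (GlIdx n K → ℝ) → ℂ) :
    ∫ s, Ψ (rFlow (g : Matrix (Fin n) (Fin n) (mixedSpace K)) s) =
      ((|(LinearMap.det (rFlow (g : Matrix (Fin n) (Fin n) (mixedSpace K))))⁻¹| : ℝ) : ℂ) * ∫ s, Ψ s := by
  have hdet := det_rFlow_ne_zero g
  have hmap := Measure.map_linearMap_addHaar_eq_smul_addHaar (μ := (volume : Measure (GlIdx n K → ℝ))) hdet
  have h1 := integral_map_equiv (μ := (volume : Measure (GlIdx n K → ℝ))) (rFlowMeasurableEquiv g) Ψ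
  rw [coe_rFlowMeasurableEquiv] at h1
  rw [← h1]
  change ∫ y, Ψ y ∂(Measure.map (rFlow (g : Matrix (Fin n) (Fin n) (mixedSpace K))) volume) = _
  rw [hmap, integral_smul_measure, ENNReal.toReal_ofReal (abs_nonneg _), RCLike.real_smul_eq_coe_mul]
  rfl

/-! ### 3. One-parameter flows: derivatives -/

open NormedSpace in -- for `exp`
/-- The generator of the flow `t ↦ rFlow (exp tX) s` at `s`: the coordinates of `matOf s · X`.
[folklore] -/
def flowGen (X : Matrix (Fin n) (Fin n) (mixedSpace K)) (s : GlIdx n K → ℝ) : GlIdx n K → ℝ :=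
  glCoord n K (matOf s * X)

/-- `flowGen X` is a continuous (indeed linear) function of `s`. [folklore] -/
theorem continuous_flowGen (X : Matrix (Fin n) (Fin n) (mixedSpace K)) : Continuous (flowGen X) :=
  (glCoord n K).continuous.comp ((glCoord n K).symm.continuous.mul continuous_const)

open NormedSpace in -- for `exp`
/-- **The flow has velocity `flowGen`**: `t ↦ rFlow (exp tX) s` has derivative `flowGen X s` at
`t = 0`. [folklore] -/
theorem hasDerivAt_rFlow_expGL (X : Matrix (Fin n) (Fin n) (mixedSpace K)) (s : GlIdx n K → ℝ) :
    HasDerivAt (fun t : ℝ ↦ rFlow (expGL (t • X) : Matrix (Fin n) (Fin n) (mixedSpace K)) s)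
      (flowGen X s) 0 := by
  have hexp : HasDerivAt (fun t : ℝ ↦ exp (t • X)) X 0 := by
    have h := hasDerivAt_exp_smul_const (𝕂 := ℝ) X 0
    rwa [zero_smul, exp_zero, one_mul] at h
  have hmul : HasDerivAt (fun t : ℝ ↦ matOf s * exp (t • X)) (matOf s * X) 0 := hexp.const_mul _
  have hcomp := ((glCoord n K).toContinuousLinearMap.hasFDerivAt (x := matOf s * exp ((0 : ℝ) • X))).comp_hasDerivAt
    (0 : ℝ) hmul
  have e : (fun t : ℝ ↦ rFlow (expGL (t • X) : Matrix (Fin n) (Fin n) (mixedSpace K)) s) =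
      (glCoord n K).toContinuousLinearMap ∘ fun t : ℝ ↦ matOf s * exp (t • X) := by
    funext t
    rw [Function.comp_apply, rFlow_apply, coe_expGL]
    rfl
  rw [e]
  exact hcomp

/-- The flow derivative of a differentiable function `χ` on the coordinate space:
`d/dt|₀ χ (rFlow (exp tX) s) = Dχ(s) (flowGen X s)`. [folklore] -/
theorem hasDerivAt_comp_rFlow_expGL {χ : (GlIdx n K → ℝ) → ℝ} {s : GlIdx n K → ℝ}
    (hχ : DifferentiableAt ℝ χ s) (X : Matrix (Fin n) (Fin n) (mixedSpace K)) :
    HasDerivAt (fun t : ℝ ↦ χ (rFlow (expGL (t • X) : Matrix (Fin n) (Fin n) (mixedSpace K)) s))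
      (fderiv ℝ χ s (flowGen X s)) 0 := by
  have h := hasDerivAt_rFlow_expGL X s
  have h0 : rFlow (expGL ((0 : ℝ) • X) : Matrix (Fin n) (Fin n) (mixedSpace K)) s = s := by
    rw [zero_smul, expGL_zero, Units.val_one, rFlow_one, LinearMap.id_apply]
  have hχ' : HasFDerivAt χ (fderiv ℝ χ s)
      (rFlow (expGL ((0 : ℝ) • X) : Matrix (Fin n) (Fin n) (mixedSpace K)) s) := by
    rw [h0]; exact hχ.hasFDerivAt
  exact hχ'.comp_hasDerivAt (0 : ℝ) h

/-! ### 4. Orbit pull-backs of functions on `GL_n(𝔸_K)` -/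

section Orbit

variable (hcpt : isCompact_glFiniteIntegralLevel n K)

/-- **The orbit pull-back**: for `F : GL_n(𝔸_K) → ℂ` and `y ∈ GL_n(𝔸_K)`, the function
`g ↦ F (y · ι(g))` on `GL_n(K_∞)` read in coordinates (by `0` off the units). [folklore] -/
def orbitPull (y : (AdelicGroupData.gl n K).Adelic) (F : (AdelicGroupData.gl n K).Adelic → ℂ) :
    (GlIdx n K → ℝ) → ℂ :=
  unitPull fun g ↦ F (y * (AutomorphyDatum.gl n K hcpt).ofArch (carrierOf g))

/-- Unfolding of `orbitPull`. [folklore] -/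
theorem orbitPull_def (y : (AdelicGroupData.gl n K).Adelic) (F : (AdelicGroupData.gl n K).Adelic → ℂ) :
    orbitPull hcpt y F = unitPull fun g ↦ F (y * (AutomorphyDatum.gl n K hcpt).ofArch (carrierOf g)) := rfl

/-- `orbitPull` is additive in `F`. [folklore] -/
theorem orbitPull_add (y : (AdelicGroupData.gl n K).Adelic) (F₁ F₂ : (AdelicGroupData.gl n K).Adelic → ℂ) :
    orbitPull hcpt y (F₁ + F₂) = orbitPull hcpt y F₁ + orbitPull hcpt y F₂ := by
  rw [orbitPull, orbitPull, orbitPull, ← unitPull_add]; rfl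

/-- `orbitPull` is homogeneous in `F`. [folklore] -/
theorem orbitPull_smul (y : (AdelicGroupData.gl n K).Adelic) (c : ℂ) (F : (AdelicGroupData.gl n K).Adelic → ℂ) :
    orbitPull hcpt y (c • F) = c • orbitPull hcpt y F := by
  rw [orbitPull, orbitPull, ← unitPull_smul]; rfl

/-- `orbitPull` commutes with pointwise products. [folklore] -/
theorem orbitPull_mul (y : (AdelicGroupData.gl n K).Adelic) (F₁ F₂ : (AdelicGroupData.gl n K).Adelic → ℂ) :
    orbitPull hcpt y (F₁ * F₂) = orbitPull hcpt y F₁ * orbitPull hcpt y F₂ := by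
  rw [orbitPull, orbitPull, orbitPull, ← unitPull_mul]; rfl

/-- `orbitPull` commutes with complex conjugation. [folklore] -/
theorem orbitPull_star (y : (AdelicGroupData.gl n K).Adelic) (F : (AdelicGroupData.gl n K).Adelic → ℂ) :
    orbitPull hcpt y (star F) = star (orbitPull hcpt y F) := by
  rw [orbitPull, orbitPull, ← unitPull_star]; rfl

/-- `orbitPull` on the units. [folklore] -/
theorem orbitPull_of_mem (y : (AdelicGroupData.gl n K).Adelic) (F : (AdelicGroupData.gl n K).Adelic → ℂ)
    {s : GlIdx n K → ℝ} (hs : s ∈ glUnitSet n K) :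
    orbitPull hcpt y F s =
      F (y * (AutomorphyDatum.gl n K hcpt).ofArch (carrierOf ((glUnitChart n K).symm (matOf s)))) :=
  unitPull_of_mem _ hs

/-- `orbitPull` vanishes off the units. [folklore] -/
theorem orbitPull_of_not_mem (y : (AdelicGroupData.gl n K).Adelic) (F : (AdelicGroupData.gl n K).Adelic → ℂ)
    {s : GlIdx n K → ℝ} (hs : s ∉ glUnitSet n K) : orbitPull hcpt y F s = 0 :=
  unitPull_of_not_mem _ hs

/-- The orbit function `g ↦ F (y · ι(g))` is continuous on `GL_n(K_∞)` for continuous `F`. [folklore] -/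
theorem continuous_orbit {F : (AdelicGroupData.gl n K).Adelic → ℂ} (hF : Continuous F)
    (y : (AdelicGroupData.gl n K).Adelic) :
    Continuous fun g : GL (Fin n) (mixedSpace K) ↦ F (y * (AutomorphyDatum.gl n K hcpt).ofArch (carrierOf g)) :=
  hF.comp (continuous_const.mul ((AutomorphyDatum.gl n K hcpt).continuous_ofArch.comp
    (Continuous.subtype_mk continuous_id _)))

/-- `orbitPull hcpt y F` is continuous on `glUnitSet` for continuous `F`. [folklore] -/
theorem continuousOn_orbitPull {F : (AdelicGroupData.gl n K).Adelic → ℂ} (hF : Continuous F)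
    (y : (AdelicGroupData.gl n K).Adelic) : ContinuousOn (orbitPull hcpt y F) (glUnitSet n K) :=
  continuousOn_unitPull (continuous_orbit hcpt hF y)

/-- **The flow derivative of an orbit pull-back is the orbit pull-back of the Lie derivative**:
for `F` smooth in the archimedean variable, `X ∈ 𝔤` and every `s`,
`d/dt|₀ orbitPull y F (rFlow (exp tX) s) = orbitPull y (X F) s` (off the units both sides
vanish; on the units this is `IsArchSmooth.hasDerivAt_flow_zero` at the point `y ι(val⁻¹ s)`).
Borel–Jacquet 1979, §1.5. [cite: BorelJacquetCorvallis1979, §1.5] -/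
theorem hasDerivAt_orbitPull_rFlow {F : (AdelicGroupData.gl n K).Adelic → ℂ}
    (hF : IsArchSmooth (AutomorphyDatum.gl n K hcpt).ofArch F) (X : (AutomorphyDatum.gl n K hcpt).arch.lie)
    (y : (AdelicGroupData.gl n K).Adelic) (s : GlIdx n K → ℝ) :
    HasDerivAt (fun t : ℝ ↦ orbitPull hcpt y F
        (rFlow (expGL (t • (X : Matrix (Fin n) (Fin n) (mixedSpace K))) : Matrix (Fin n) (Fin n) (mixedSpace K)) s))
      (orbitPull hcpt y (lieDeriv (AutomorphyDatum.gl n K hcpt).ofArch X F) s) 0 := by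
  by_cases hs : s ∈ glUnitSet n K
  · -- on the units: the flow of `F` at the point `y ι(u)`, `u = val⁻¹ (matOf s)`
    have e : (fun t : ℝ ↦ orbitPull hcpt y F
        (rFlow (expGL (t • (X : Matrix (Fin n) (Fin n) (mixedSpace K))) : Matrix (Fin n) (Fin n) (mixedSpace K)) s)) =
        fun t : ℝ ↦ F ((y * (AutomorphyDatum.gl n K hcpt).ofArch (carrierOf ((glUnitChart n K).symm (matOf s)))) *
          (AutomorphyDatum.gl n K hcpt).ofArch ((AutomorphyDatum.gl n K hcpt).arch.expMem (t • X))) := by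
      funext t
      rw [orbitPull, unitPull_rFlow, unitPull_of_mem _ hs, mul_assoc, ← map_mul]
      rfl
    have hval : orbitPull hcpt y (lieDeriv (AutomorphyDatum.gl n K hcpt).ofArch X F) s =
        lieDeriv (AutomorphyDatum.gl n K hcpt).ofArch X F
          (y * (AutomorphyDatum.gl n K hcpt).ofArch (carrierOf ((glUnitChart n K).symm (matOf s)))) := by
      rw [orbitPull, unitPull_of_mem _ hs]
    rw [e, hval]
    exact hF.hasDerivAt_flow_zero (AutomorphyDatum.gl n K hcpt).ofArch X _
  · -- off the units: both sides vanish
    have e : (fun t : ℝ ↦ orbitPull hcpt y F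
        (rFlow (expGL (t • (X : Matrix (Fin n) (Fin n) (mixedSpace K))) : Matrix (Fin n) (Fin n) (mixedSpace K)) s)) =
        fun _ ↦ 0 := by
      funext t
      rw [orbitPull, unitPull_rFlow, unitPull_of_not_mem _ hs]
    have hval : orbitPull hcpt y (lieDeriv (AutomorphyDatum.gl n K hcpt).ofArch X F) s = 0 := by
      rw [orbitPull, unitPull_of_not_mem _ hs]
    rw [e, hval]
    exact hasDerivAt_const 0 (0 : ℂ)

end Orbit

/-! ### 5. A cut-off at the identity -/

/-- Some closed ball around the coordinates of `1` consists of coordinates of invertible matrices.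
[folklore] -/
theorem exists_closedBall_subset_glUnitSet :
    ∃ ε > (0 : ℝ), Metric.closedBall (glCoord n K 1) ε ⊆ glUnitSet n K := by
  have h1 : glCoord n K 1 ∈ glUnitSet n K := by
    rw [mem_glUnitSet_iff, matOf_glCoord]; exact isUnit_one
  obtain ⟨ε, hε, hball⟩ := Metric.mem_nhds_iff.1 (isOpen_glUnitSet.mem_nhds h1)
  exact ⟨ε / 2, half_pos hε, (Metric.closedBall_subset_ball (half_lt_self hε)).trans hball⟩

variable (n K) in
/-- **A cut-off at the identity**: a smooth bump function on the coordinate space, centred at the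
coordinates of `1`, with outer radius so small that its support consists of coordinates of
invertible matrices. [folklore] -/
def glCutoff : ContDiffBump (glCoord n K (1 : Matrix (Fin n) (Fin n) (mixedSpace K))) where
  rIn := (Classical.choose (exists_closedBall_subset_glUnitSet (n := n) (K := K))) / 2
  rOut := Classical.choose (exists_closedBall_subset_glUnitSet (n := n) (K := K))
  rIn_pos := half_pos (Classical.choose_spec (exists_closedBall_subset_glUnitSet (n := n) (K := K))).1
  rIn_lt_rOut := half_lt_self (Classical.choose_spec (exists_closedBall_subset_glUnitSet (n := n) (K := K))).1

/-- The outer radius of the cut-off (definitional). [folklore] -/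
theorem glCutoff_rOut : (glCutoff n K).rOut = Classical.choose (exists_closedBall_subset_glUnitSet (n := n) (K := K)) :=
  rfl

/-- The support of the cut-off consists of coordinates of invertible matrices. [folklore] -/
theorem tsupport_glCutoff_subset : tsupport (glCutoff n K) ⊆ glUnitSet n K := by
  rw [(glCutoff n K).tsupport_eq, glCutoff_rOut]
  exact (Classical.choose_spec (exists_closedBall_subset_glUnitSet (n := n) (K := K))).2

/-- The cut-off is smooth. [folklore] -/
theorem contDiff_glCutoff : ContDiff ℝ ∞ (glCutoff n K) := (glCutoff n K).contDiff

/-- The cut-off is continuous. [folklore] -/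
theorem continuous_glCutoff : Continuous (glCutoff n K) := (glCutoff n K).continuous

/-- The cut-off has compact support. [folklore] -/
theorem hasCompactSupport_glCutoff : HasCompactSupport (glCutoff n K) := (glCutoff n K).hasCompactSupport

/-- `0 ≤ χ ≤ 1`. [folklore] -/
theorem glCutoff_nonneg (s : GlIdx n K → ℝ) : 0 ≤ glCutoff n K s := (glCutoff n K).nonneg

/-- `χ ≤ 1`. [folklore] -/
theorem glCutoff_le_one (s : GlIdx n K → ℝ) : glCutoff n K s ≤ 1 := (glCutoff n K).le_one

/-- `χ = 1` near the coordinates of `1`. [folklore] -/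
theorem glCutoff_eventuallyEq_one : (glCutoff n K : (GlIdx n K → ℝ) → ℝ) =ᶠ[𝓝 (glCoord n K 1)] 1 :=
  (glCutoff n K).eventuallyEq_one

/-- **The flow derivative of the cut-off** along `X`: `s ↦ Dχ(s) (flowGen X s)`, a continuous
compactly supported function. [folklore] -/
def glCutoffDeriv (X : Matrix (Fin n) (Fin n) (mixedSpace K)) (s : GlIdx n K → ℝ) : ℝ :=
  fderiv ℝ (glCutoff n K) s (flowGen X s)

/-- The flow derivative of the cut-off at time `0` is `glCutoffDeriv`. [folklore] -/
theorem hasDerivAt_glCutoff_rFlow (X : Matrix (Fin n) (Fin n) (mixedSpace K)) (s : GlIdx n K → ℝ) :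
    HasDerivAt (fun t : ℝ ↦ glCutoff n K (rFlow (expGL (t • X) : Matrix (Fin n) (Fin n) (mixedSpace K)) s))
      (glCutoffDeriv X s) 0 :=
  hasDerivAt_comp_rFlow_expGL
    (((contDiff_glCutoff (n := n) (K := K)).differentiable (by simp)).differentiableAt) X

/-- The flow derivative of the cut-off is continuous. [folklore] -/
theorem continuous_glCutoffDeriv (X : Matrix (Fin n) (Fin n) (mixedSpace K)) : Continuous (glCutoffDeriv X) := by
  unfold glCutoffDeriv
  exact ((contDiff_glCutoff (n := n) (K := K)).continuous_fderiv (by simp)).clm_apply (continuous_flowGen X)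

/-- The flow derivative of the cut-off has compact support. [folklore] -/
theorem hasCompactSupport_glCutoffDeriv (X : Matrix (Fin n) (Fin n) (mixedSpace K)) :
    HasCompactSupport (glCutoffDeriv X) := by
  refine ((hasCompactSupport_glCutoff (n := n) (K := K)).fderiv (𝕜 := ℝ)).mono' ?_
  intro s hs
  apply subset_tsupport
  rw [Function.mem_support] at hs ⊢
  contrapose! hs
  rw [glCutoffDeriv, hs]
  rfl

/-- A uniform bound for the flow derivative of the cut-off. [folklore] -/
theorem exists_bound_glCutoffDeriv (X : Matrix (Fin n) (Fin n) (mixedSpace K)) :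
    ∃ C : ℝ, 0 ≤ C ∧ ∀ s, |glCutoffDeriv X s| ≤ C := by
  obtain ⟨C, hC⟩ := (continuous_glCutoffDeriv X).bounded_above_of_compact_support (hasCompactSupport_glCutoffDeriv X)
  exact ⟨max C 0, le_max_right _ _, fun s ↦ (Real.norm_eq_abs _ ▸ hC s).trans (le_max_left _ _)⟩

/-! ### 6. Integration by parts along the flows: `∫ Ψ' = κ_X ∫ Ψ` -/

open NormedSpace in -- for `exp`
/-- The flow map `(t, s) ↦ rFlow (exp tX) s` is jointly continuous. [folklore] -/
theorem continuous_rFlow_expGL_uncurry (X : Matrix (Fin n) (Fin n) (mixedSpace K)) :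
    Continuous fun p : ℝ × (GlIdx n K → ℝ) ↦
      rFlow (expGL (p.1 • X) : Matrix (Fin n) (Fin n) (mixedSpace K)) p.2 := by
  have e : (fun p : ℝ × (GlIdx n K → ℝ) ↦ rFlow (expGL (p.1 • X) : Matrix (Fin n) (Fin n) (mixedSpace K)) p.2) =
      fun p ↦ glCoord n K (matOf p.2 * exp (p.1 • X)) := by
    funext p; rw [rFlow_apply, coe_expGL]
  rw [e]
  refine (glCoord n K).continuous.comp (((glCoord n K).symm.continuous.comp continuous_snd).mul ?_)
  exact NormedSpace.exp_continuous.comp (continuous_fst.smul continuous_const)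

/-- The backward flow map `(t, s) ↦ rFlow (exp (-t)X) s` is jointly continuous. [folklore] -/
theorem continuous_rFlow_expGL_neg_uncurry (X : Matrix (Fin n) (Fin n) (mixedSpace K)) :
    Continuous fun p : ℝ × (GlIdx n K → ℝ) ↦
      rFlow (expGL ((-p.1) • X) : Matrix (Fin n) (Fin n) (mixedSpace K)) p.2 := by
  have h := continuous_rFlow_expGL_uncurry (-X)
  simp only [smul_neg] at h
  simpa [neg_smul] using h

/-- Flow identity: `rFlow (exp uX) s = rFlow (exp (u-t)X) (rFlow (exp tX) s)`. [folklore] -/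
theorem rFlow_expGL_eq_comp (X : Matrix (Fin n) (Fin n) (mixedSpace K)) (t u : ℝ) (s : GlIdx n K → ℝ) :
    rFlow (expGL (u • X) : Matrix (Fin n) (Fin n) (mixedSpace K)) s =
      rFlow (expGL ((u - t) • X) : Matrix (Fin n) (Fin n) (mixedSpace K))
        (rFlow (expGL (t • X) : Matrix (Fin n) (Fin n) (mixedSpace K)) s) := by
  rw [← rFlow_mul_apply, ← Units.val_mul, ← expGL_add_smul, add_sub_cancel]

/-- The flow is undone by the backward flow: `rFlow (exp (-t)X) (rFlow (exp tX) s) = s`. [folklore] -/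
theorem rFlow_expGL_neg_rFlow_expGL (X : Matrix (Fin n) (Fin n) (mixedSpace K)) (t : ℝ) (s : GlIdx n K → ℝ) :
    rFlow (expGL ((-t) • X) : Matrix (Fin n) (Fin n) (mixedSpace K))
      (rFlow (expGL (t • X) : Matrix (Fin n) (Fin n) (mixedSpace K)) s) = s := by
  rw [← rFlow_mul_apply, ← Units.val_mul, ← expGL_add_smul, add_neg_cancel, zero_smul, expGL_zero,
    Units.val_one, rFlow_one, LinearMap.id_apply]

/-- **Differentiation under the integral along a flow.** Let `Ψ, Ψ'` be continuous with compact
support and suppose `t ↦ Ψ (rFlow (exp tX) s)` has derivative `Ψ' s` at `t = 0` for every `s`.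
Then `t ↦ ∫ Ψ (rFlow (exp tX) s) ds` has derivative `∫ Ψ'` at `t = 0` (dominated
differentiation: along the flow the derivative at time `t` is `Ψ' (rFlow (exp tX) s)`, bounded by
`sup |Ψ'|` on a compact set). [folklore] -/
theorem hasDerivAt_integral_comp_rFlow (X : Matrix (Fin n) (Fin n) (mixedSpace K))
    {Ψ Ψ' : (GlIdx n K → ℝ) → ℂ} (hΨ : Continuous Ψ) (hΨs : HasCompactSupport Ψ)
    (hΨ' : Continuous Ψ') (hΨ's : HasCompactSupport Ψ')
    (hflow : ∀ s, HasDerivAt (fun t : ℝ ↦ Ψ (rFlow (expGL (t • X) : Matrix (Fin n) (Fin n) (mixedSpace K)) s)) (Ψ' s) 0) :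
    HasDerivAt (fun t : ℝ ↦ ∫ s, Ψ (rFlow (expGL (t • X) : Matrix (Fin n) (Fin n) (mixedSpace K)) s))
      (∫ s, Ψ' s) 0 := by
  -- derivatives along the flow at every time
  have hderiv : ∀ (s : GlIdx n K → ℝ) (t : ℝ),
      HasDerivAt (fun u : ℝ ↦ Ψ (rFlow (expGL (u • X) : Matrix (Fin n) (Fin n) (mixedSpace K)) s))
        (Ψ' (rFlow (expGL (t • X) : Matrix (Fin n) (Fin n) (mixedSpace K)) s)) t := by
    intro s t
    have h0 : HasDerivAt (fun u : ℝ ↦ Ψ (rFlow (expGL (u • X) : Matrix (Fin n) (Fin n) (mixedSpace K))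
        (rFlow (expGL (t • X) : Matrix (Fin n) (Fin n) (mixedSpace K)) s)))
        (Ψ' (rFlow (expGL (t • X) : Matrix (Fin n) (Fin n) (mixedSpace K)) s)) (t - t) := by
      rw [sub_self]; exact hflow _
    have e : (fun u : ℝ ↦ Ψ (rFlow (expGL (u • X) : Matrix (Fin n) (Fin n) (mixedSpace K)) s)) = fun u : ℝ ↦
        Ψ (rFlow (expGL ((u - t) • X) : Matrix (Fin n) (Fin n) (mixedSpace K))
          (rFlow (expGL (t • X) : Matrix (Fin n) (Fin n) (mixedSpace K)) s)) := by
      funext u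
      rw [← rFlow_expGL_eq_comp]
    rw [e]
    exact h0.comp_sub_const t t
  -- a bound for `Ψ'` and the compact set carrying the derivatives for `|t| ≤ 1`
  obtain ⟨B, hB⟩ := hΨ'.bounded_above_of_compact_support hΨ's
  have hB0 : 0 ≤ B := (norm_nonneg _).trans (hB 0)
  obtain ⟨𝒦, h𝒦⟩ : ∃ 𝒦 : Set (GlIdx n K → ℝ), 𝒦 =
      (fun p : ℝ × (GlIdx n K → ℝ) ↦ rFlow (expGL ((-p.1) • X) : Matrix (Fin n) (Fin n) (mixedSpace K)) p.2) ''
        (Icc (-1 : ℝ) 1 ×ˢ tsupport Ψ') := ⟨_, rfl⟩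
  have h𝒦c : IsCompact 𝒦 := by
    rw [h𝒦]
    exact (isCompact_Icc.prod hΨ's).image (continuous_rFlow_expGL_neg_uncurry X)
  have hbound : ∀ (s : GlIdx n K → ℝ), ∀ t ∈ Metric.closedBall (0 : ℝ) 1,
      ‖Ψ' (rFlow (expGL (t • X) : Matrix (Fin n) (Fin n) (mixedSpace K)) s)‖ ≤ 𝒦.indicator (fun _ ↦ B) s := by
    intro s t ht
    by_cases h0 : Ψ' (rFlow (expGL (t • X) : Matrix (Fin n) (Fin n) (mixedSpace K)) s) = 0
    · rw [h0, norm_zero]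
      exact Set.indicator_nonneg (fun _ _ ↦ hB0) s
    · have hmem : rFlow (expGL (t • X) : Matrix (Fin n) (Fin n) (mixedSpace K)) s ∈ tsupport Ψ' :=
        subset_tsupport _ h0
      have hs𝒦 : s ∈ 𝒦 := by
        rw [h𝒦]
        refine ⟨(t, rFlow (expGL (t • X) : Matrix (Fin n) (Fin n) (mixedSpace K)) s), ⟨?_, hmem⟩, ?_⟩
        · rw [Metric.mem_closedBall, dist_zero_right, Real.norm_eq_abs, abs_le] at ht
          exact ht
        · exact rFlow_expGL_neg_rFlow_expGL X t s
      rw [Set.indicator_of_mem hs𝒦]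
      exact hB _
  have hmeas : ∀ t : ℝ, AEStronglyMeasurable
      (fun s ↦ Ψ (rFlow (expGL (t • X) : Matrix (Fin n) (Fin n) (mixedSpace K)) s)) (volume : Measure (GlIdx n K → ℝ)) :=
    fun t ↦ (hΨ.comp (continuous_rFlow _)).aestronglyMeasurable
  have hmeas' : AEStronglyMeasurable
      (fun s ↦ Ψ' (rFlow (expGL ((0 : ℝ) • X) : Matrix (Fin n) (Fin n) (mixedSpace K)) s)) (volume : Measure (GlIdx n K → ℝ)) :=
    (hΨ'.comp (continuous_rFlow _)).aestronglyMeasurable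
  have h0flow : ∀ s : GlIdx n K → ℝ, rFlow (expGL ((0 : ℝ) • X) : Matrix (Fin n) (Fin n) (mixedSpace K)) s = s := by
    intro s
    rw [zero_smul, expGL_zero, Units.val_one, rFlow_one, LinearMap.id_apply]
  have e0 : (fun s ↦ Ψ (rFlow (expGL ((0 : ℝ) • X) : Matrix (Fin n) (Fin n) (mixedSpace K)) s)) = Ψ :=
    funext fun s ↦ by rw [h0flow]
  have e0' : (fun s ↦ Ψ' (rFlow (expGL ((0 : ℝ) • X) : Matrix (Fin n) (Fin n) (mixedSpace K)) s)) = Ψ' :=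
    funext fun s ↦ by rw [h0flow]
  have hint : Integrable (fun s ↦ Ψ (rFlow (expGL ((0 : ℝ) • X) : Matrix (Fin n) (Fin n) (mixedSpace K)) s))
      (volume : Measure (GlIdx n K → ℝ)) := by
    rw [e0]; exact hΨ.integrable_of_hasCompactSupport hΨs
  have hbint : Integrable (𝒦.indicator fun _ ↦ B) (volume : Measure (GlIdx n K → ℝ)) :=
    (integrable_indicator_iff h𝒦c.measurableSet).2 (integrableOn_const (h𝒦c.measure_lt_top).ne)
  have h := hasDerivAt_integral_of_dominated_loc_of_deriv_le (μ := (volume : Measure (GlIdx n K → ℝ)))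
    (x₀ := (0 : ℝ)) (s := Metric.closedBall (0 : ℝ) 1)
    (F := fun (t : ℝ) (s : GlIdx n K → ℝ) ↦ Ψ (rFlow (expGL (t • X) : Matrix (Fin n) (Fin n) (mixedSpace K)) s))
    (F' := fun (t : ℝ) (s : GlIdx n K → ℝ) ↦ Ψ' (rFlow (expGL (t • X) : Matrix (Fin n) (Fin n) (mixedSpace K)) s))
    (bound := 𝒦.indicator fun _ ↦ B) (Metric.closedBall_mem_nhds (0 : ℝ) one_pos)
    (Eventually.of_forall hmeas) hint hmeas'
    (Eventually.of_forall fun s t ht ↦ hbound s t ht) hbint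
    (Eventually.of_forall fun s t _ ↦ hderiv s t)
  refine h.2.congr_deriv ?_
  show (∫ a, Ψ' (rFlow (expGL ((0 : ℝ) • X) : Matrix (Fin n) (Fin n) (mixedSpace K)) a)) = ∫ s, Ψ' s
  rw [e0']

/-- The cut-off read as a complex function (the reference function of `exists_flowDivergence`).
[folklore] -/
def glCutoffC (n : ℕ) (K : Type) [Field K] [NumberField K] (s : GlIdx n K → ℝ) : ℂ := (glCutoff n K s : ℂ)

/-- Its flow derivative along `X`, read as a complex function. [folklore] -/
def glCutoffDerivC (X : Matrix (Fin n) (Fin n) (mixedSpace K)) (s : GlIdx n K → ℝ) : ℂ := (glCutoffDeriv X s : ℂ)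

/-- The complex cut-off is continuous. [folklore] -/
theorem continuous_glCutoffC : Continuous (glCutoffC n K) :=
  Complex.continuous_ofReal.comp continuous_glCutoff

/-- The complex cut-off has compact support. [folklore] -/
theorem hasCompactSupport_glCutoffC : HasCompactSupport (glCutoffC n K) :=
  hasCompactSupport_glCutoff.comp_left Complex.ofReal_zero

/-- The complex flow derivative of the cut-off is continuous. [folklore] -/
theorem continuous_glCutoffDerivC (X : Matrix (Fin n) (Fin n) (mixedSpace K)) : Continuous (glCutoffDerivC X) :=
  Complex.continuous_ofReal.comp (continuous_glCutoffDeriv X)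

/-- The complex flow derivative of the cut-off has compact support. [folklore] -/
theorem hasCompactSupport_glCutoffDerivC (X : Matrix (Fin n) (Fin n) (mixedSpace K)) :
    HasCompactSupport (glCutoffDerivC X) :=
  (hasCompactSupport_glCutoffDeriv X).comp_left Complex.ofReal_zero

/-- The flow derivative of the complex cut-off at time `0`. [folklore] -/
theorem hasDerivAt_glCutoffC_rFlow (X : Matrix (Fin n) (Fin n) (mixedSpace K)) (s : GlIdx n K → ℝ) :
    HasDerivAt (fun t : ℝ ↦ glCutoffC n K (rFlow (expGL (t • X) : Matrix (Fin n) (Fin n) (mixedSpace K)) s))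
      (glCutoffDerivC X s) 0 :=
  (hasDerivAt_glCutoff_rFlow X s).ofReal_comp

/-- The cut-off has nonzero integral. [folklore] -/
theorem integral_glCutoffC_ne_zero : (∫ s, glCutoffC n K s) ≠ 0 := by
  unfold glCutoffC
  rw [integral_complex_ofReal, Complex.ofReal_ne_zero]
  exact ((glCutoff n K).integral_pos (μ := (volume : Measure (GlIdx n K → ℝ)))).ne'

/-- Unfolding of the complex cut-off. [folklore] -/
theorem glCutoffC_apply (s : GlIdx n K → ℝ) : glCutoffC n K s = (glCutoff n K s : ℂ) := rfl

/-- `‖χ s‖ = χ s`. [folklore] -/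
theorem norm_glCutoffC (s : GlIdx n K → ℝ) : ‖glCutoffC n K s‖ = glCutoff n K s := by
  rw [glCutoffC_apply, Complex.norm_real, Real.norm_eq_abs, abs_of_nonneg (glCutoff_nonneg s)]

/-- `‖χ s‖ ≤ 1`. [folklore] -/
theorem norm_glCutoffC_le_one (s : GlIdx n K → ℝ) : ‖glCutoffC n K s‖ ≤ 1 := by
  rw [norm_glCutoffC]; exact glCutoff_le_one s

/-- The complex cut-off is real (`conj χ = χ`). [folklore] -/
theorem star_glCutoffC (s : GlIdx n K → ℝ) : star (glCutoffC n K s) = glCutoffC n K s := by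
  rw [glCutoffC_apply]; exact Complex.conj_ofReal _

/-- The support of the complex cut-off consists of coordinates of invertible matrices. [folklore] -/
theorem tsupport_glCutoffC_subset : tsupport (glCutoffC n K) ⊆ glUnitSet n K := by
  refine Set.Subset.trans ?_ tsupport_glCutoff_subset
  apply tsupport_comp_subset Complex.ofReal_zero

/-- Unfolding of the complex flow derivative of the cut-off. [folklore] -/
theorem glCutoffDerivC_apply (X : Matrix (Fin n) (Fin n) (mixedSpace K)) (s : GlIdx n K → ℝ) :
    glCutoffDerivC X s = (glCutoffDeriv X s : ℂ) := rfl

/-- A uniform bound for the complex flow derivative of the cut-off. [folklore] -/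
theorem exists_bound_glCutoffDerivC (X : Matrix (Fin n) (Fin n) (mixedSpace K)) :
    ∃ C : ℝ, 0 ≤ C ∧ ∀ s, ‖glCutoffDerivC X s‖ ≤ C := by
  obtain ⟨C, hC0, hC⟩ := exists_bound_glCutoffDeriv X
  exact ⟨C, hC0, fun s ↦ by rw [glCutoffDerivC_apply, Complex.norm_real, Real.norm_eq_abs]; exact hC s⟩

/-- **The flows have a constant divergence**: for each `X` there is `κ ∈ ℂ` such that
`∫ Ψ' = κ ∫ Ψ` whenever `Ψ, Ψ'` are continuous with compact support and `Ψ'` is the flow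
derivative of `Ψ` along `X` at time `0` (Lebesgue measure is rescaled by the linear maps
`rFlow (exp tX)`, `integral_comp_rFlow`; compare with the reference pair given by the cut-off, and
use `hasDerivAt_integral_comp_rFlow`). For Haar measure `κ` would vanish; here only its existence
matters. [folklore] -/
theorem exists_flowDivergence (X : Matrix (Fin n) (Fin n) (mixedSpace K)) :
    ∃ κ : ℂ, ∀ (Ψ Ψ' : (GlIdx n K → ℝ) → ℂ), Continuous Ψ → HasCompactSupport Ψ →
      Continuous Ψ' → HasCompactSupport Ψ' →
      (∀ s, HasDerivAt (fun t : ℝ ↦ Ψ (rFlow (expGL (t • X) : Matrix (Fin n) (Fin n) (mixedSpace K)) s)) (Ψ' s) 0) →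
        ∫ s, Ψ' s = κ * ∫ s, Ψ s := by
  refine ⟨(∫ s, glCutoffDerivC X s) / ∫ s, glCutoffC n K s, fun Ψ Ψ' hΨ hΨs hΨ' hΨ's hflow ↦ ?_⟩
  -- `J_Ψ(t) I₀ = J₀(t) I_Ψ` for all `t` (both are `c(t) I_Ψ I₀`)
  have hJ : (fun t : ℝ ↦ (∫ s, Ψ (rFlow (expGL (t • X) : Matrix (Fin n) (Fin n) (mixedSpace K)) s)) * ∫ s, glCutoffC n K s) =
      fun t : ℝ ↦ (∫ s, glCutoffC n K (rFlow (expGL (t • X) : Matrix (Fin n) (Fin n) (mixedSpace K)) s)) * ∫ s, Ψ s := by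
    funext t
    rw [integral_comp_rFlow (n := n) (K := K) (expGL (t • X)) Ψ,
      integral_comp_rFlow (n := n) (K := K) (expGL (t • X)) (glCutoffC n K)]
    ring
  have h1 := (hasDerivAt_integral_comp_rFlow X hΨ hΨs hΨ' hΨ's hflow).mul_const (∫ s, glCutoffC n K s)
  have h2 := (hasDerivAt_integral_comp_rFlow X continuous_glCutoffC hasCompactSupport_glCutoffC
    (continuous_glCutoffDerivC X) (hasCompactSupport_glCutoffDerivC X) (hasDerivAt_glCutoffC_rFlow X)).mul_const
    (∫ s, Ψ s)
  rw [hJ] at h1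
  have huniq := h1.unique h2
  have hI₀ne := integral_glCutoffC_ne_zero (n := n) (K := K)
  field_simp
  linear_combination huniq

end Literature.NumberTheory.Automorphic
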